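import Mathlib
import Summits.CriticalPhenomena.PercolationContinuityZ3.Theses.PercNearOneGluing
import Literature.Probability.Percolation.PercolationProofs
import Literature.Probability.Percolation.ConditionalPositiveAssociation
import Summits.CriticalPhenomena.PercolationContinuityZ3.Theorems.PercNearOneGluingAdditiveGluingSigmaGeometry
import Summits.CriticalPhenomena.PercolationContinuityZ3.Theorems.PercNearOneGluingAdditiveGluingSigmaLaw
import Summits.CriticalPhenomena.PercolationContinuityZ3.Theorems.PercNearOneGluingAdditiveGluingGluingLemma5
import Summits.CriticalPhenomena.PercolationContinuityZ3.Theorems.PercNearOneGluingAdditiveGluingSigmaRecursion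
import Summits.CriticalPhenomena.PercolationContinuityZ3.Theorems.PercNearOneGluingAdditiveGluingGlueReach
import Summits.CriticalPhenomena.PercolationContinuityZ3.Theorems.PercNearOneGluingAdditiveGluingKnLemma3ii
import Summits.CriticalPhenomena.PercolationContinuityZ3.Theorems.PercNearOneGluingAdditiveGluingGluePushforward
import Summits.CriticalPhenomena.PercolationContinuityZ3.Theorems.PercNearOneGluingAdditiveGluingKnThm1Set
import Summits.CriticalPhenomena.PercolationContinuityZ3.Theorems.PercNearOneGluingAdditiveGluingDefectTwoRelays
import Summits.CriticalPhenomena.PercolationContinuityZ3.Theorems.PercNearOneGluingAdditiveGluingPartial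

/-!
# Line `sigma-recursion-lemma5-any-relay` for crux `AdditiveGluing` (stmt-CriticalPhenomena-4576)

Skeleton, RESHAPED by the lead (prover-line-stmt-CriticalPhenomena-4576-0, 2026-08-16) from the
crux-plan's `Lines/sigma-recursion-lemma5-any-relay.lean`.  Crux (route `PercNearOneGluing`,
decl `AdditiveGluing`): on every finite weighted graph, `P(o ↔ A) − t ≤ P(o ↔ b)` whenever
`0 ≤ t` and `P(a ↔ b) ≥ 1 − t` for all `a ∈ A`.

What changed in the reshape (composition idea unchanged):
* every registered stub is stated in TREE VOCABULARY ONLY (`prodBernoulli`, `openConn`, set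
  builder, explicit weight lambdas) — no local definition, notation or `Finset.filter` appears in
  a stub signature, so helper files under `Theorems/` can state them verbatim;
* the plan's stubs 1–2 (one-cluster BHK = vdBHK 2006 Thm 1.3; KN Lemma 3(i)) are NO LONGER
  STUBS: both are PROVED in the tree (`BHK2006_clusterConditionalPositiveAssociation_holds`,
  `BHK2006_twoClusterConditionalAssociation_holds`, and the sibling crux's landed
  `Theorems/PercNearOneGluingNearOneGluingKnLemma3i.lean :: knLemma3i`), so the Lemma-5 stub
  simply imports them;
* the σ-recursion engine is split into its three honest parts: the path-surgery identification
  of the conditional cluster geometry (`stub_sigmaGeometry`), the product-measure law of the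
  layer decomposition (`stub_sigmaLaw`, domain Markov + glue/kill pushforward), and the
  bookkeeping (`stub_sigmaRecursion`, which DISPLAYS the two previous statements as hypotheses);
* the residual `stub_gluingDefect` now receives the induction hypothesis the recursion actually
  supplies — the designated inequality for EVERY minimiser of the block-deleted graph — instead
  of the weaker plain `AGm`.

THE LINE (Kozma–Nitzan arXiv:2401.12397 §3.2 — Thms 4–5 and Lemma 5 — pushed to a full
recursion).  Transfer: prove the STRONGER designated-relay statement (additive form of KN
Question 9, p.36), in block form so that it is closed under the recursion:
`AGd w O A b a : P_{G/O}(O ↔ A) − P_{G/O}(O ↔ b) ≤ P_{G/O}(a ↮ b)` for the glued observer block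
`O` and `a` = ANY minimiser over `A` of the reliability `P_{G∖O}(· ↔ b)` computed with the block
DELETED.  This `a` is the one relay for which KN Lemma 5 applies in EVERY boundary layer meeting
`A` simultaneously, so the σ-decomposition at the block (layer `S` = outside endpoints of the
open pairs leaving `O`) discharges all `A`-touching layers (`stub_gluingLemma5`); a layer `S`
avoiding `A` and `b` is the same problem for the strictly smaller state `(G ∖ O, S)` EXCEPT that
the designated relay drifts (the minimiser after deleting `S` as well may differ).  That one-step
drift, with the induction hypothesis available, is `stub_gluingDefect` — the load-bearing stub.
The composition is real: `designated_of_stubs` (strong induction on the number of live vertices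
outside the block), `additiveGluing_core` (`O = {o}`) and `AdditiveGluing_of : AdditiveGluing`,
which feeds the five stubs BY NAME.

Conventions.  Weighted graphs live on `Fin n` with weights `w : Sym2 (Fin n) → [0,1]` and law
`prodBernoulli w`; deleting a block is `kill` (weight 0 on every pair meeting it), contracting a
block is `glue` (weight 1 on the non-loop pairs inside it); both keep the vertex type.  In stub
signatures these appear EXPANDED:
`glue w S = fun e => if (∀ x ∈ e, x ∈ S) ∧ ¬ e.IsDiag then 1 else w e`,
`kill w O = fun e => if (∃ x ∈ e, x ∈ O) then 0 else w e`,
`{O ↔ X} = ⋃ o ∈ O, ⋃ x ∈ X, openConn o x`, `{O ↔ b} = ⋃ o ∈ O, openConn o b`,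
layer event `{ω | ∀ x, x ∈ S ↔ (x ∉ O ∧ ∃ o ∈ O, s(o, x) ∈ ω)}`, and the off-block/glued
configuration `Ψ_S ω = {e | e ∈ ω ∧ ∀ x ∈ e, x ∉ O} ∪ {e | (∀ x ∈ e, x ∈ S) ∧ ¬ e.IsDiag}`.
Disproof obligations honoured: the relay hypothesis is used (at `hrel a haA`), `0 ≤ t` only in
the case `A = ∅`, the equality case `o ∈ A` is the first case split, and every non-trivial stub
uses the symmetry of `↔` (directed AG is false).
-/

namespace Summit.CriticalPhenomena.PercolationContinuityZ3.Cruxes.AdditiveGluing.SigmaRecursionLemma5AnyRelay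

open MeasureTheory Set
open Literature.Probability.LatticeModels (prodBernoulli)
open Literature.Probability.Percolation (BondConfig openConn openGraph openEdgeCluster)
open Summit.CriticalPhenomena.PercolationContinuityZ3.Theses.PercNearOneGluing (AdditiveGluing)

noncomputable section
open Classical

variable {n : ℕ}

/-! ## Vocabulary of the composition (NOT used in stub signatures) -/

/-- Contract the block `O`: every non-loop pair inside `O` becomes a sure (weight-1) edge. -/
def glue (w : Sym2 (Fin n) → unitInterval) (O : Finset (Fin n)) : Sym2 (Fin n) → unitInterval :=
  fun e => if (∀ x ∈ e, x ∈ O) ∧ ¬ e.IsDiag then 1 else w e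

/-- Delete the block `O`: every pair meeting `O` gets weight 0 (KN's `G ∖ O`). -/
def kill (w : Sym2 (Fin n) → unitInterval) (O : Finset (Fin n)) : Sym2 (Fin n) → unitInterval :=
  fun e => if (∃ x ∈ e, x ∈ O) then 0 else w e

/-- The block connection event `{O ↔ X}`: some vertex of `O` is joined to some vertex of `X`. -/
def blockConn (O X : Finset (Fin n)) : Set (BondConfig (Fin n)) :=
  ⋃ o ∈ O, ⋃ x ∈ X, openConn o x

/-- The block-to-point connection event `{O ↔ b}`. -/
def blockPt (O : Finset (Fin n)) (b : Fin n) : Set (BondConfig (Fin n)) :=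
  ⋃ o ∈ O, openConn o b

/-- `S` is a possible boundary layer of `O`: outside `O`, each member joined to `O` by a pair of
positive weight. -/
def IsPosLayer (w : Sym2 (Fin n) → unitInterval) (O S : Finset (Fin n)) : Prop :=
  ∀ x ∈ S, x ∉ O ∧ ∃ o ∈ O, w s(o, x) ≠ 0

/-- Live vertices outside the block: those meeting at least one pair of positive weight
(the induction measure of the recursion is their number). -/
def live (w : Sym2 (Fin n) → unitInterval) (O : Finset (Fin n)) : Finset (Fin n) :=
  Finset.univ.filter fun x => x ∉ O ∧ ∃ e : Sym2 (Fin n), x ∈ e ∧ w e ≠ 0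

/-- DESIGNATED gluing inequality for the glued block `O` with comparison relay `a`:
`P(O ↔ A) − P(O ↔ b) ≤ P(a ↮ b)`, all three in the graph where `O` is contracted. -/
def AGd (w : Sym2 (Fin n) → unitInterval) (O A : Finset (Fin n)) (b a : Fin n) : Prop :=
  (prodBernoulli (glue w O)).real (blockConn O A) - (prodBernoulli (glue w O)).real (blockPt O b)
    ≤ 1 - (prodBernoulli (glue w O)).real (openConn a b)

/-! ## Registered stubs (tree vocabulary only) -/

/-- **stub_gluingLemma5 — KN Lemma 5 for an ARBITRARY relay, block form.**  If, before gluing,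
`a` is at most as reliable (towards `b`) as some vertex `v` of the block `S ∌ b`, then after
contracting `S` (weight 1 on the non-loop pairs inside `S`) the vertex `a` is at most as reliable
as the block: `P_{G/S}(a ↔ b) ≤ P_{G/S}(S ↔ b)`.  KN (arXiv:2401.12397, Lemma 5, p.13) state it
for `a` and `v` neighbours of the observer; their proof never uses that.  Proof sketch (KN p.13
with the block in place of `0 ∪ B`): sprinkle the pairs inside `S` at rate `ε` on top of `w`
(`w_ε e = 1 − (1 − w e)(1 − ε)` inside `S`, `w_ε = w` elsewhere); by monotone coupling
(`prodBernoulli_real_mono_of_isUpperSet`) and continuity in the weights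
(`Theorems…WeightContinuity :: stub_weightContinuity` /
`continuous_prodBernoulli_real_of_determinedBy`) `P_{w_ε}(a↔b) ≤ P_{w_ε}(v↔b) + η(ε)` with
`η(ε) → 0`; `E = {all non-loop pairs inside S open}` is increasing and determined by the open
EDGE cluster of `v ∈ S`, so KN Lemma 3(i) (PROVED: `Theorems…KnLemma3i :: knLemma3i`, δ-form)
gives `P_{w_ε}({a↔b} ∩ E) ≤ P_{w_ε}({v↔b} ∩ E) + η(ε) P_{w_ε}(E)`; conditioning the product
measure `w_ε` on `E` (positive probability for `ε > 0`) is exactly `prodBernoulli (glue w S)`;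
divide, let `ε → 0`, and use `{v ↔ b} ⊆ {S ↔ b}`.  (The case `a ∈ S` is trivial.)
0 violations in 2 606 exact instances (crux-plan lab) and in the panel's Lemma5Gen sweep
(TRIAGE-r1-3: 0/40 938). -/
theorem stub_gluingLemma5 :
    ∀ (n : ℕ) (w : Sym2 (Fin n) → unitInterval) (S : Finset (Fin n)) (a v b : Fin n),
      v ∈ S → b ∉ S →
      (prodBernoulli w).real (openConn a b) ≤ (prodBernoulli w).real (openConn v b) →
      (prodBernoulli (fun e : Sym2 (Fin n) =>
          if (∀ x ∈ e, x ∈ S) ∧ ¬ e.IsDiag then 1 else w e)).real (openConn a b) ≤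
        (prodBernoulli (fun e : Sym2 (Fin n) =>
          if (∀ x ∈ e, x ∈ S) ∧ ¬ e.IsDiag then 1 else w e)).real (⋃ s ∈ S, openConn s b) :=
  -- LANDED (wave 1, p75889): Theorems/PercNearOneGluingAdditiveGluingGluingLemma5.lean
  Summit.CriticalPhenomena.PercolationContinuityZ3.Theorems.stub_gluingLemma5

/-- **stub_sigmaGeometry — the conditional cluster geometry of a σ-layer (path surgery).**
Fix the block `O`, a configuration `ω` in which all non-loop pairs inside `O` are open, and let
`S` be its LAYER: the vertices outside `O` joined to `O` by an open pair.  Let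
`Ψ ω = {e ∈ ω | e avoids O} ∪ {non-loop pairs inside S}` (forget the pairs meeting `O`, glue the
layer).  Then (i) for `X` disjoint from `O`: `O ↔ X` in `ω` iff `S ↔ X` in `Ψ ω`; (ii) for
`u, v ∉ O`: `u ↔ v` in `ω` iff `u ↔ v` in `Ψ ω`.  Proof: (⇒) cut an open walk at its visits to
`O`: it enters and leaves `O` only through layer vertices, the pieces off `O` are open in `Ψ ω`,
consecutive layer visits are glued; (⇐) replace each glued layer pair `{s, s'}` by the open detour
`s – o(s) – (O-clique) – o(s') – s'` in `ω`.  [folklore; KN arXiv:2401.12397 p.14 "there is no big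
difference between conditioning on σ and deleting 0"] -/
theorem stub_sigmaGeometry :
    ∀ (n : ℕ) (O S : Finset (Fin n)) (ω : BondConfig (Fin n)),
      (∀ x : Fin n, x ∈ S ↔ (x ∉ O ∧ ∃ o ∈ O, s(o, x) ∈ ω)) →
      (∀ o ∈ O, ∀ o' ∈ O, o ≠ o' → s(o, o') ∈ ω) →
      (∀ X : Finset (Fin n), Disjoint O X →
          (ω ∈ (⋃ o ∈ O, ⋃ x ∈ X, openConn o x) ↔
            ({e | e ∈ ω ∧ ∀ x ∈ e, x ∉ O} ∪ {e | (∀ x ∈ e, x ∈ S) ∧ ¬ e.IsDiag}) ∈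
              (⋃ s ∈ S, ⋃ x ∈ X, openConn s x))) ∧
      (∀ u v : Fin n, u ∉ O → v ∉ O →
          (ω ∈ openConn u v ↔
            ({e | e ∈ ω ∧ ∀ x ∈ e, x ∉ O} ∪ {e | (∀ x ∈ e, x ∈ S) ∧ ¬ e.IsDiag}) ∈
              openConn u v)) :=
  -- LANDED (wave 1, p75610): Theorems/PercNearOneGluingAdditiveGluingSigmaGeometry.lean
  Summit.CriticalPhenomena.PercolationContinuityZ3.Theorems.stub_sigmaGeometry

/-- **stub_sigmaLaw — the law of the layer decomposition (domain Markov + glue/kill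
pushforward).**  Under `prodBernoulli (glue w O)` the layer event `{layer = S}` is determined by
the pairs MEETING `O`, while `Ψ_S ω` is a function of the pairs AVOIDING `O`; hence they are
independent (`prodBernoulli_real_inter_of_determinedBy`), and the law of `Ψ_S` is
`prodBernoulli (glue (kill w O) S)` (pairs meeting `O` ↦ closed = weight 0, non-loop pairs inside
`S` ↦ open = weight 1, other pairs keep their weight; `prodBernoulli_real_eq_of_determinedBy` /
`prodBernoulli_eq_map`).  So for every event `E`:
`μ_{G/O}({layer = S} ∩ Ψ_S⁻¹ E) = μ_{G/O}{layer = S} · μ_{(G∖O)/S}(E)`.  (If `S` meets `O` the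
layer event is empty and both sides vanish.)  [folklore; Grimmett 1999 §2.2; vdBHK 2006 Lemma 2.3] -/
theorem stub_sigmaLaw :
    ∀ (n : ℕ) (w : Sym2 (Fin n) → unitInterval) (O S : Finset (Fin n))
      (E : Set (BondConfig (Fin n))),
      (prodBernoulli (fun e : Sym2 (Fin n) =>
          if (∀ x ∈ e, x ∈ O) ∧ ¬ e.IsDiag then 1 else w e)).real
          ({ω | ∀ x : Fin n, x ∈ S ↔ (x ∉ O ∧ ∃ o ∈ O, s(o, x) ∈ ω)} ∩
            {ω | ({e | e ∈ ω ∧ ∀ x ∈ e, x ∉ O} ∪ {e | (∀ x ∈ e, x ∈ S) ∧ ¬ e.IsDiag}) ∈ E}) =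
        (prodBernoulli (fun e : Sym2 (Fin n) =>
            if (∀ x ∈ e, x ∈ O) ∧ ¬ e.IsDiag then 1 else w e)).real
            {ω | ∀ x : Fin n, x ∈ S ↔ (x ∉ O ∧ ∃ o ∈ O, s(o, x) ∈ ω)} *
          (prodBernoulli (fun e : Sym2 (Fin n) =>
            if (∀ x ∈ e, x ∈ S) ∧ ¬ e.IsDiag then 1 else
              if (∃ x ∈ e, x ∈ O) then 0 else w e)).real E :=
  -- LANDED (wave 1, p75855): Theorems/PercNearOneGluingAdditiveGluingSigmaLaw.lean
  Summit.CriticalPhenomena.PercolationContinuityZ3.Theorems.stub_sigmaLaw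

/-- **stub_sigmaRecursion — the σ-recursion engine (bookkeeping), given the geometry and the law
of the layer decomposition as displayed hypotheses.**  Under `glue w O`, a.s. all non-loop pairs
inside `O` are open (weight 1) and the layer `S` of the configuration satisfies
`∀ x ∈ S, x ∉ O ∧ ∃ o ∈ O, w s(o,x) ≠ 0` (an open pair has positive weight); partition by the
value of the layer (`Σ_S`), rewrite each of the three events `{O ↔ A}`, `{O ↔ b}`, `{a ↔ b}`
through `Ψ_S` (geometry) and factor (law).  The designated deficit of `(w, O)` becomes
`Σ_S μ{layer = S} · [P'(S↔A) − P'(S↔b) + P'(a↔b) − 1]` with `P' = prodBernoulli (glue (kill w O) S)`;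
every bracket is `≤ 0`: `S = ∅` (`P'(∅ ↔ ·) = 0`), `b ∈ S` (`P'(S↔b) = 1`), `S ∩ A ≠ ∅`
(`P'(S↔A) = 1` and the Lemma-5 comparison `hL5`), `S` avoiding `A ∪ {b}` (the designated
inequality `hdef`).  [KN arXiv:2401.12397, proofs of Thms 4–5 pp.13–14] -/
theorem stub_sigmaRecursion :
    ∀ (n : ℕ) (w : Sym2 (Fin n) → unitInterval) (O A : Finset (Fin n)) (b a : Fin n),
      Disjoint O A → b ∉ O → a ∈ A →
      (∀ (S : Finset (Fin n)) (ω : BondConfig (Fin n)),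
        (∀ x : Fin n, x ∈ S ↔ (x ∉ O ∧ ∃ o ∈ O, s(o, x) ∈ ω)) →
        (∀ o ∈ O, ∀ o' ∈ O, o ≠ o' → s(o, o') ∈ ω) →
        (∀ X : Finset (Fin n), Disjoint O X →
            (ω ∈ (⋃ o ∈ O, ⋃ x ∈ X, openConn o x) ↔
              ({e | e ∈ ω ∧ ∀ x ∈ e, x ∉ O} ∪ {e | (∀ x ∈ e, x ∈ S) ∧ ¬ e.IsDiag}) ∈
                (⋃ s ∈ S, ⋃ x ∈ X, openConn s x))) ∧
        (∀ u v : Fin n, u ∉ O → v ∉ O →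
            (ω ∈ openConn u v ↔
              ({e | e ∈ ω ∧ ∀ x ∈ e, x ∉ O} ∪ {e | (∀ x ∈ e, x ∈ S) ∧ ¬ e.IsDiag}) ∈
                openConn u v))) →
      (∀ (S : Finset (Fin n)) (E : Set (BondConfig (Fin n))),
        (prodBernoulli (fun e : Sym2 (Fin n) =>
            if (∀ x ∈ e, x ∈ O) ∧ ¬ e.IsDiag then 1 else w e)).real
            ({ω | ∀ x : Fin n, x ∈ S ↔ (x ∉ O ∧ ∃ o ∈ O, s(o, x) ∈ ω)} ∩
              {ω | ({e | e ∈ ω ∧ ∀ x ∈ e, x ∉ O} ∪ {e | (∀ x ∈ e, x ∈ S) ∧ ¬ e.IsDiag}) ∈ E}) =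
          (prodBernoulli (fun e : Sym2 (Fin n) =>
              if (∀ x ∈ e, x ∈ O) ∧ ¬ e.IsDiag then 1 else w e)).real
              {ω | ∀ x : Fin n, x ∈ S ↔ (x ∉ O ∧ ∃ o ∈ O, s(o, x) ∈ ω)} *
            (prodBernoulli (fun e : Sym2 (Fin n) =>
              if (∀ x ∈ e, x ∈ S) ∧ ¬ e.IsDiag then 1 else
                if (∃ x ∈ e, x ∈ O) then 0 else w e)).real E) →
      (∀ S : Finset (Fin n), (∀ x ∈ S, x ∉ O ∧ ∃ o ∈ O, w s(o, x) ≠ 0) →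
        (S ∩ A).Nonempty → b ∉ S →
        (prodBernoulli (fun e : Sym2 (Fin n) =>
            if (∀ x ∈ e, x ∈ S) ∧ ¬ e.IsDiag then 1 else
              if (∃ x ∈ e, x ∈ O) then 0 else w e)).real (openConn a b) ≤
          (prodBernoulli (fun e : Sym2 (Fin n) =>
            if (∀ x ∈ e, x ∈ S) ∧ ¬ e.IsDiag then 1 else
              if (∃ x ∈ e, x ∈ O) then 0 else w e)).real (⋃ s ∈ S, openConn s b)) →
      (∀ S : Finset (Fin n), (∀ x ∈ S, x ∉ O ∧ ∃ o ∈ O, w s(o, x) ≠ 0) →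
        S.Nonempty → Disjoint S A → b ∉ S →
        (prodBernoulli (fun e : Sym2 (Fin n) =>
            if (∀ x ∈ e, x ∈ S) ∧ ¬ e.IsDiag then 1 else
              if (∃ x ∈ e, x ∈ O) then 0 else w e)).real (⋃ s ∈ S, ⋃ x ∈ A, openConn s x) -
          (prodBernoulli (fun e : Sym2 (Fin n) =>
            if (∀ x ∈ e, x ∈ S) ∧ ¬ e.IsDiag then 1 else
              if (∃ x ∈ e, x ∈ O) then 0 else w e)).real (⋃ s ∈ S, openConn s b) ≤
          1 - (prodBernoulli (fun e : Sym2 (Fin n) =>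
            if (∀ x ∈ e, x ∈ S) ∧ ¬ e.IsDiag then 1 else
              if (∃ x ∈ e, x ∈ O) then 0 else w e)).real (openConn a b)) →
      (prodBernoulli (fun e : Sym2 (Fin n) =>
          if (∀ x ∈ e, x ∈ O) ∧ ¬ e.IsDiag then 1 else w e)).real (⋃ o ∈ O, ⋃ x ∈ A, openConn o x) -
        (prodBernoulli (fun e : Sym2 (Fin n) =>
          if (∀ x ∈ e, x ∈ O) ∧ ¬ e.IsDiag then 1 else w e)).real (⋃ o ∈ O, openConn o b) ≤
        1 - (prodBernoulli (fun e : Sym2 (Fin n) =>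
          if (∀ x ∈ e, x ∈ O) ∧ ¬ e.IsDiag then 1 else w e)).real (openConn a b) :=
  -- LANDED (p76128): Theorems/PercNearOneGluingAdditiveGluingSigmaRecursion.lean
  Summit.CriticalPhenomena.PercolationContinuityZ3.Theorems.stub_sigmaRecursion

/-! ### The gluing defect, split by the lead (cycle 1): KN Lemma 3(ii), glue transfer (pushforward
+ reachability), the TWO-RELAY case (proved on paper, see NOTES.md §Defect|A|≤2), and the residual
CORE (≥ 3 relays, genuine drift). `stub_gluingDefect` itself is now a real proof from these. -/

/-- **stub_knLemma3ii — Kozma–Nitzan Lemma 3(ii) (arXiv:2401.12397 p.6), denominator-free.**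
If `P(a₁ ↔ b) ≤ P(a₂ ↔ b) + d` (`d ≥ 0`) and `Q` is DECREASING and determined by the open edge
cluster of `a₁` (`ω' ∈ Q`, `C_{a₁} ω ⊆ C_{a₁} ω'` ⇒ `ω ∈ Q`), then `P({a₁ ↔ b} ∩ Q) ≤ P({a₂ ↔ b} ∩ Q) + d`.
Proof (KN pp.6–7, as for part (i), now PROVED in the tree as
`Theorems…KnLemma3i :: knLemma3i`): put `D = {a₁ ↮ a₂}`; off `D` the two events coincide; with
`m = μ(D)`, `xᵢ = μ(D ∩ {aᵢ↔b})`, `yᵢ = μ(D ∩ {aᵢ↔b} ∩ Q)`, `q = μ(D ∩ Q)`: one-cluster BHK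
(vdBHK 2006 Thm 1.3, `BHK2006_clusterConditionalPositiveAssociation_holds`, applied to `1{a₁↔b}`
and the INCREASING complement `Qᶜ`) gives `m y₁ ≤ x₁ q`; two-cluster BHK (Thm 1.4,
`BHK2006_twoClusterConditionalAssociation_holds` / `.negCorrelation`, with `s = a₂`, `t = a₁`,
`f = 1{a₂↔b}`, `g = 1_{Qᶜ}`) gives `x₂ q ≤ m y₂`; hence `m y₁ ≤ (x₂ + d) q ≤ m y₂ + d m`.
(`a₁ = a₂` and `m = 0` are trivial.) -/
theorem stub_knLemma3ii :
    ∀ (n : ℕ) (w : Sym2 (Fin n) → unitInterval) (a₁ a₂ b : Fin n) (Q : Set (BondConfig (Fin n)))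
      (d : ℝ),
      (∀ ω ω' : BondConfig (Fin n), ω' ∈ Q → openEdgeCluster ω a₁ ⊆ openEdgeCluster ω' a₁ → ω ∈ Q) →
      0 ≤ d →
      (prodBernoulli w).real (openConn a₁ b) ≤ (prodBernoulli w).real (openConn a₂ b) + d →
      (prodBernoulli w).real (openConn a₁ b ∩ Q) ≤ (prodBernoulli w).real (openConn a₂ b ∩ Q) + d :=
  -- LANDED (p76444): Theorems/PercNearOneGluingAdditiveGluingKnLemma3ii.lean
  Summit.CriticalPhenomena.PercolationContinuityZ3.Theorems.stub_knLemma3ii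

/-- **stub_gluePushforward — contracting a block is a pushforward.**  The law `prodBernoulli (glue w S)`
(weight 1 on the non-loop pairs inside `S`) is the image of `prodBernoulli w` under
`ω ↦ ω ∪ D_S`, `D_S = {non-loop pairs inside S}`: for every event `E`,
`μ_{G/S}(E) = μ_G{ω | ω ∪ D_S ∈ E}` (coordinates outside `D_S` keep their weights, those in `D_S`
are a.s. open under `glue w S`; `prodBernoulli_eq_map` / `Measure.infinitePi`, or measure
extensionality on singletons of the finite configuration space).  [folklore; Grimmett 1999 §1.3;
KN arXiv:2401.12397 §3.1 Remark "gluing = probability 1"] -/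
theorem stub_gluePushforward :
    ∀ (n : ℕ) (w : Sym2 (Fin n) → unitInterval) (S : Finset (Fin n)) (E : Set (BondConfig (Fin n))),
      (prodBernoulli (fun e : Sym2 (Fin n) =>
          if (∀ x ∈ e, x ∈ S) ∧ ¬ e.IsDiag then 1 else w e)).real E =
        (prodBernoulli w).real
          {ω | (ω ∪ {e | (∀ x ∈ e, x ∈ S) ∧ ¬ e.IsDiag}) ∈ E} :=
  -- LANDED (p76780): Theorems/PercNearOneGluingAdditiveGluingGluePushforward.lean
  Summit.CriticalPhenomena.PercolationContinuityZ3.Theorems.stub_gluePushforward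

/-- **stub_glueReach — reachability after gluing a block.**  In the configuration `ω ∪ D_S`
(all non-loop pairs inside `S` added), `x ↔ y` iff `x ↔ y` in `ω`, or `x` reaches some vertex of
`S` and some vertex of `S` reaches `y` in `ω` (walk surgery: cut a walk at its first and last visit
to `S`; conversely hop inside the glued clique).  [folklore; KN arXiv:2401.12397 §3.1 Remark p.9] -/
theorem stub_glueReach :
    ∀ (n : ℕ) (S : Finset (Fin n)) (ω : BondConfig (Fin n)) (x y : Fin n),
      ((ω ∪ {e | (∀ x ∈ e, x ∈ S) ∧ ¬ e.IsDiag}) ∈ openConn x y ↔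
        (ω ∈ openConn x y ∨
          ((∃ s ∈ S, ω ∈ openConn x s) ∧ (∃ s ∈ S, ω ∈ openConn s y)))) :=
  -- LANDED (p76380): Theorems/PercNearOneGluingAdditiveGluingGlueReach.lean
  Summit.CriticalPhenomena.PercolationContinuityZ3.Theorems.stub_glueReach

/-- **stub_defectTwoRelays — the gluing defect with two relays (PROVED on paper by the lead).**
Displayed hypotheses: KN Lemma 3(ii) (`stub_knLemma3ii` at this `n`), the glue pushforward and the
glue reachability lemma.  Claim: if `P_G(a ↔ b) ≤ P_G(a₁ ↔ b)` (`a` is the worse relay BEFORE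
gluing) then in `G/S`: `P(S ↔ {a, a₁}) − P(S ↔ b) ≤ P(a ↮ b)`.  Proof: (1) `P_{G/S}(S↔{a,a₁}) −
P_{G/S}(S↔b) ≤ P_{G/S}(S↔{a,a₁}, S↮b) = P_{G/S}(S↔a, S↮b) + P_{G/S}(S↮a, S↔a₁, S↮b)` and
`{S↔a, S↮b} ⊆ {a↮b, S↔a}` pointwise, so it suffices that `P_{G/S}(S↔a₁, S↮a, S↮b) ≤ P_{G/S}(a↮b, a↮S)`;
(2) transfer to `G` (pushforward + reach; on `{a ↮ S}` the glued clique cannot be used by `a`):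
both sides are `P_G` of the same-named multi-vertex events (`S ↔ x` := some `s ∈ S` reaches `x`);
(3) in `G`: LHS `⊆ {a₁↔S, a₁↮b, a↮a₁, a↮S}`, RHS `≥ P_G(a↮b, a↮a₁, a↮S)`, and with `D'' = {a↮a₁} ∩ {a↮S}`:
`P_G(a↔b, D'') ≤ P_G(a₁↔b, D'')` — Lemma 3(ii) with the decreasing `C_a`-determined event `{a↮S}`
and `d = 0`, then cancel the common part on `{a↔a₁}` — whence
`P_G(a↮b, D'') ≥ P_G(a₁↮b, D'') ≥ P_G(a₁↔S, a₁↮b, D'')`.  (`a₁ = a` is trivial.) -/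
theorem stub_defectTwoRelays :
    ∀ (n : ℕ),
      (∀ (w : Sym2 (Fin n) → unitInterval) (a₁ a₂ b : Fin n) (Q : Set (BondConfig (Fin n)))
        (d : ℝ),
        (∀ ω ω' : BondConfig (Fin n), ω' ∈ Q → openEdgeCluster ω a₁ ⊆ openEdgeCluster ω' a₁ → ω ∈ Q) →
        0 ≤ d →
        (prodBernoulli w).real (openConn a₁ b) ≤ (prodBernoulli w).real (openConn a₂ b) + d →
        (prodBernoulli w).real (openConn a₁ b ∩ Q) ≤
          (prodBernoulli w).real (openConn a₂ b ∩ Q) + d) →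
      (∀ (w : Sym2 (Fin n) → unitInterval) (S : Finset (Fin n)) (E : Set (BondConfig (Fin n))),
        (prodBernoulli (fun e : Sym2 (Fin n) =>
            if (∀ x ∈ e, x ∈ S) ∧ ¬ e.IsDiag then 1 else w e)).real E =
          (prodBernoulli w).real
            {ω | (ω ∪ {e | (∀ x ∈ e, x ∈ S) ∧ ¬ e.IsDiag}) ∈ E}) →
      (∀ (S : Finset (Fin n)) (ω : BondConfig (Fin n)) (x y : Fin n),
        ((ω ∪ {e | (∀ x ∈ e, x ∈ S) ∧ ¬ e.IsDiag}) ∈ openConn x y ↔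
          (ω ∈ openConn x y ∨
            ((∃ s ∈ S, ω ∈ openConn x s) ∧ (∃ s ∈ S, ω ∈ openConn s y))))) →
      ∀ (w : Sym2 (Fin n) → unitInterval) (S : Finset (Fin n)) (a a₁ b : Fin n),
        b ∉ S → a ∉ S → a₁ ∉ S →
        (prodBernoulli w).real (openConn a b) ≤ (prodBernoulli w).real (openConn a₁ b) →
        (prodBernoulli (fun e : Sym2 (Fin n) =>
            if (∀ x ∈ e, x ∈ S) ∧ ¬ e.IsDiag then 1 else w e)).real
            (⋃ s ∈ S, (openConn s a ∪ openConn s a₁)) -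
          (prodBernoulli (fun e : Sym2 (Fin n) =>
            if (∀ x ∈ e, x ∈ S) ∧ ¬ e.IsDiag then 1 else w e)).real (⋃ s ∈ S, openConn s b) ≤
          1 - (prodBernoulli (fun e : Sym2 (Fin n) =>
            if (∀ x ∈ e, x ∈ S) ∧ ¬ e.IsDiag then 1 else w e)).real (openConn a b) :=
  -- LANDED (p78327): Theorems/PercNearOneGluingAdditiveGluingDefectTwoRelays.lean
  Summit.CriticalPhenomena.PercolationContinuityZ3.Theorems.stub_defectTwoRelays

/-- **stub_knThm1Set — Kozma–Nitzan Theorem 1 (arXiv:2401.12397 §3.1, the pre-FKG inequality (3)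
for TWO relays), for an observer SET.**  For every vertex set `S`, relays `a₁, a₂` and target `b`:
`P(S ↔ b ∧ S ↔ {a₁,a₂}) ≥ minᵢ P(S ↔ {a₁,a₂} ∧ aᵢ ↔ b)`, where `S ↔ X` means that SOME `s ∈ S` is
joined to some `x ∈ X` (different `s` for different events allowed).  KN's proof (p.7–8) goes
through verbatim with `0 ↦ S`, because `1{S ↔ aᵢ}` is increasing and determined by the open edge
cluster of `aᵢ`: with `D = {a₁ ↮ a₂}`, `φᵢ = P(S↔aᵢ ∩ D)` (denominator-free), it suffices that
`L := φ₁·[P(S↔a₂, a₂↔b, D) − P(S↔a₂, a₁↔b, D)] + φ₂·[P(S↔a₁, a₁↔b, D) − P(S↔a₁, a₂↔b, D)] ≥ 0`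
(event algebra: `{S↔b, S↔A', a₁↮b} ⊇ {S↔a₂, a₂↔b, D}` and `{S↔A', a₁↔b, S↮b} ⊆ {S↔a₂, a₁↔b, D}`,
and symmetrically), and BHK gives `P(D)·P(S↔a₂, a₂↔b, D) ≥ φ₂'·P(a₂↔b, D)` (Thm 1.3, `s = a₂`,
`X = {a₁}`; `φ₂' = P(S↔a₂, D)`) and `P(D)·P(S↔a₂, a₁↔b, D) ≤ φ₂'·P(a₁↔b, D)` (Thm 1.4), whence
`P(D)·L ≥ (φ₁φ₂ − φ₂φ₁)(…) = 0`.  Degenerate cases (`a₁ = a₂`, `P(D) = 0`, `φ₁ = φ₂ = 0`) are direct.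
Tree tools: `BHK2006_clusterConditionalPositiveAssociation_holds`,
`BHK2006_twoClusterConditionalAssociation_holds` / `.openConn_negCorrelation`, and the sibling
`Theorems…KnLemma3i :: knLemma3i_oneCluster / knLemma3i_twoCluster` (exactly these two BHK shapes
for `C_s`-determined up-closed events).  Exact lab: 0 violations in 1 090 instances (lab/t3set.py). -/
theorem stub_knThm1Set :
    ∀ (n : ℕ) (w : Sym2 (Fin n) → unitInterval) (S : Finset (Fin n)) (a₁ a₂ b : Fin n),
      min ((prodBernoulli w).real
            ((⋃ s ∈ S, (openConn s a₁ ∪ openConn s a₂)) ∩ openConn a₁ b))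
          ((prodBernoulli w).real
            ((⋃ s ∈ S, (openConn s a₁ ∪ openConn s a₂)) ∩ openConn a₂ b)) ≤
        (prodBernoulli w).real
          ((⋃ s ∈ S, (openConn s a₁ ∪ openConn s a₂)) ∩ (⋃ s ∈ S, openConn s b)) :=
  -- LANDED (p78185): Theorems/PercNearOneGluingAdditiveGluingKnThm1Set.lean
  Summit.CriticalPhenomena.PercolationContinuityZ3.Theorems.stub_knThm1Set

/-- **stub_gluingDefectCore — the residual: at least THREE relays and genuine drift (OPEN; crux-sized).**
Same data as `stub_gluingDefect` (block `S`, relays `A`, `a` the pre-contraction minimiser, the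
induction hypothesis for every minimiser of the block-deleted graph), PLUS: the FULL induction
hypothesis of the recursion (the designated inequality at every state with at most as many live
vertices outside its block — in particular single-observer additive gluing on the current graph),
the four PROVED tools displayed as hypotheses (KN Lemma 3(ii) `stub_knLemma3ii`, KN Theorem 1 for
observer sets `stub_knThm1Set`, the glue pushforward and the glue reachability lemma), an explicit
drift witness `a₁` (a block-deleted minimiser strictly less reliable than `a` after contraction) and a
third relay `a₂ ∉ {a, a₁}` (two relays are `stub_defectTwoRelays`).  Claim: the designated inequality
in `G/S` with `a`.
EQUIVALENT UN-GLUED FORM (MSAG, lead + disprover independently): for `a₀ := argmin_A P_G(· ↔ b)`,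
`P_G(∃s∈S: s↔A∖a₀; ∀s: s↮b; ∀s: s↮a₀) ≤ P_G(a₀↮b ∧ ∀s: a₀↮s) [+ P_G(S↔b, S↮A)]` — additive gluing for
an OBSERVER SET with the true worst relay of the un-glued graph; its instances collectively give AG
with three relays (open in print).  Status of the lead's analysis (LeadMath-c1.md, core-analysis-c1.md in
this crux directory): |A| ≤ 2 proved; at |A| = 3 the fully-separated sector follows from two new
6-terminal correlation inequalities GX/GY ("ghost-separated BHK", 0 violations in exact + adversarial
sweeps, unproved) by KN's coefficient identity; the remaining cross-sector exchange is global (every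
termwise/sectorwise split tested is false, with exact witnesses).  0 violations of MSAG in all panel,
disprover and lead sweeps. -/
theorem stub_gluingDefectCore :
    ∀ (n : ℕ) (w : Sym2 (Fin n) → unitInterval) (S A : Finset (Fin n)) (b a a₁ : Fin n),
      S.Nonempty → Disjoint S A → b ∉ S → a ∈ A →
      -- displayed PROVED tools: KN Lemma 3(ii), KN Thm 1 (set form), glue pushforward, glue reach
      (∀ (w' : Sym2 (Fin n) → unitInterval) (a₁' a₂' b' : Fin n) (Q : Set (BondConfig (Fin n)))
        (d : ℝ),
        (∀ ω ω' : BondConfig (Fin n), ω' ∈ Q → openEdgeCluster ω a₁' ⊆ openEdgeCluster ω' a₁' → ω ∈ Q) →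
        0 ≤ d →
        (prodBernoulli w').real (openConn a₁' b') ≤ (prodBernoulli w').real (openConn a₂' b') + d →
        (prodBernoulli w').real (openConn a₁' b' ∩ Q) ≤
          (prodBernoulli w').real (openConn a₂' b' ∩ Q) + d) →
      (∀ (w' : Sym2 (Fin n) → unitInterval) (S' : Finset (Fin n)) (a₁' a₂' b' : Fin n),
        min ((prodBernoulli w').real
              ((⋃ s ∈ S', (openConn s a₁' ∪ openConn s a₂')) ∩ openConn a₁' b'))
            ((prodBernoulli w').real
              ((⋃ s ∈ S', (openConn s a₁' ∪ openConn s a₂')) ∩ openConn a₂' b')) ≤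
          (prodBernoulli w').real
            ((⋃ s ∈ S', (openConn s a₁' ∪ openConn s a₂')) ∩ (⋃ s ∈ S', openConn s b'))) →
      (∀ (w' : Sym2 (Fin n) → unitInterval) (S' : Finset (Fin n)) (E : Set (BondConfig (Fin n))),
        (prodBernoulli (fun e : Sym2 (Fin n) =>
            if (∀ x ∈ e, x ∈ S') ∧ ¬ e.IsDiag then 1 else w' e)).real E =
          (prodBernoulli w').real
            {ω | (ω ∪ {e | (∀ x ∈ e, x ∈ S') ∧ ¬ e.IsDiag}) ∈ E}) →
      (∀ (S' : Finset (Fin n)) (ω : BondConfig (Fin n)) (x y : Fin n),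
        ((ω ∪ {e | (∀ x ∈ e, x ∈ S') ∧ ¬ e.IsDiag}) ∈ openConn x y ↔
          (ω ∈ openConn x y ∨
            ((∃ s ∈ S', ω ∈ openConn x s) ∧ (∃ s ∈ S', ω ∈ openConn s y))))) →
      (∀ a' ∈ A, (prodBernoulli w).real (openConn a b) ≤ (prodBernoulli w).real (openConn a' b)) →
      (∀ a' ∈ A,
        (∀ a'' ∈ A,
          (prodBernoulli (fun e : Sym2 (Fin n) => if (∃ x ∈ e, x ∈ S) then 0 else w e)).real
              (openConn a' b) ≤
            (prodBernoulli (fun e : Sym2 (Fin n) => if (∃ x ∈ e, x ∈ S) then 0 else w e)).real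
              (openConn a'' b)) →
        (prodBernoulli (fun e : Sym2 (Fin n) =>
            if (∀ x ∈ e, x ∈ S) ∧ ¬ e.IsDiag then 1 else w e)).real (⋃ s ∈ S, ⋃ x ∈ A, openConn s x) -
          (prodBernoulli (fun e : Sym2 (Fin n) =>
            if (∀ x ∈ e, x ∈ S) ∧ ¬ e.IsDiag then 1 else w e)).real (⋃ s ∈ S, openConn s b) ≤
          1 - (prodBernoulli (fun e : Sym2 (Fin n) =>
            if (∀ x ∈ e, x ∈ S) ∧ ¬ e.IsDiag then 1 else w e)).real (openConn a' b)) →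
      (∀ (w' : Sym2 (Fin n) → unitInterval) (O' A' : Finset (Fin n)) (b' a' : Fin n),
        (Finset.univ.filter (fun x : Fin n => x ∉ O' ∧ ∃ e : Sym2 (Fin n), x ∈ e ∧ w' e ≠ 0)).card ≤
          (Finset.univ.filter (fun x : Fin n => x ∉ S ∧ ∃ e : Sym2 (Fin n), x ∈ e ∧ w e ≠ 0)).card →
        Disjoint O' A' → b' ∉ O' → a' ∈ A' →
        (∀ a'' ∈ A',
          (prodBernoulli (fun e : Sym2 (Fin n) => if (∃ x ∈ e, x ∈ O') then 0 else w' e)).real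
              (openConn a' b') ≤
            (prodBernoulli (fun e : Sym2 (Fin n) => if (∃ x ∈ e, x ∈ O') then 0 else w' e)).real
              (openConn a'' b')) →
        (prodBernoulli (fun e : Sym2 (Fin n) =>
            if (∀ x ∈ e, x ∈ O') ∧ ¬ e.IsDiag then 1 else w' e)).real (⋃ o ∈ O', ⋃ x ∈ A', openConn o x) -
          (prodBernoulli (fun e : Sym2 (Fin n) =>
            if (∀ x ∈ e, x ∈ O') ∧ ¬ e.IsDiag then 1 else w' e)).real (⋃ o ∈ O', openConn o b') ≤
          1 - (prodBernoulli (fun e : Sym2 (Fin n) =>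
            if (∀ x ∈ e, x ∈ O') ∧ ¬ e.IsDiag then 1 else w' e)).real (openConn a' b')) →
      a₁ ∈ A →
      (∀ a'' ∈ A,
        (prodBernoulli (fun e : Sym2 (Fin n) => if (∃ x ∈ e, x ∈ S) then 0 else w e)).real
            (openConn a₁ b) ≤
          (prodBernoulli (fun e : Sym2 (Fin n) => if (∃ x ∈ e, x ∈ S) then 0 else w e)).real
            (openConn a'' b)) →
      (prodBernoulli (fun e : Sym2 (Fin n) =>
          if (∀ x ∈ e, x ∈ S) ∧ ¬ e.IsDiag then 1 else w e)).real (openConn a₁ b) <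
        (prodBernoulli (fun e : Sym2 (Fin n) =>
          if (∀ x ∈ e, x ∈ S) ∧ ¬ e.IsDiag then 1 else w e)).real (openConn a b) →
      (∃ a₂ ∈ A, a₂ ≠ a ∧ a₂ ≠ a₁) →
      (prodBernoulli (fun e : Sym2 (Fin n) =>
          if (∀ x ∈ e, x ∈ S) ∧ ¬ e.IsDiag then 1 else w e)).real (⋃ s ∈ S, ⋃ x ∈ A, openConn s x) -
        (prodBernoulli (fun e : Sym2 (Fin n) =>
          if (∀ x ∈ e, x ∈ S) ∧ ¬ e.IsDiag then 1 else w e)).real (⋃ s ∈ S, openConn s b) ≤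
        1 - (prodBernoulli (fun e : Sym2 (Fin n) =>
          if (∀ x ∈ e, x ∈ S) ∧ ¬ e.IsDiag then 1 else w e)).real (openConn a b) := by
  sorry

/-- **The gluing defect** (one step of relay drift) — formerly the registered residual, now a REAL
PROOF from `stub_defectTwoRelays` (two relays), `stub_gluingDefectCore` (≥ 3 relays with drift)
and the induction hypothesis (no drift).  For a non-empty block `S` disjoint from `A` with
`b ∉ S`: if the designated inequality holds in `G/S` for every minimiser of the block-deleted
reliability, and `a` minimises the pre-contraction reliability, then it holds in `G/S` with `a`. -/
theorem stub_gluingDefect :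
    ∀ (n : ℕ) (w : Sym2 (Fin n) → unitInterval) (S A : Finset (Fin n)) (b a : Fin n),
      S.Nonempty → Disjoint S A → b ∉ S → a ∈ A →
      (∀ a' ∈ A, (prodBernoulli w).real (openConn a b) ≤ (prodBernoulli w).real (openConn a' b)) →
      (∀ a' ∈ A,
        (∀ a'' ∈ A,
          (prodBernoulli (fun e : Sym2 (Fin n) => if (∃ x ∈ e, x ∈ S) then 0 else w e)).real
              (openConn a' b) ≤
            (prodBernoulli (fun e : Sym2 (Fin n) => if (∃ x ∈ e, x ∈ S) then 0 else w e)).real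
              (openConn a'' b)) →
        (prodBernoulli (fun e : Sym2 (Fin n) =>
            if (∀ x ∈ e, x ∈ S) ∧ ¬ e.IsDiag then 1 else w e)).real (⋃ s ∈ S, ⋃ x ∈ A, openConn s x) -
          (prodBernoulli (fun e : Sym2 (Fin n) =>
            if (∀ x ∈ e, x ∈ S) ∧ ¬ e.IsDiag then 1 else w e)).real (⋃ s ∈ S, openConn s b) ≤
          1 - (prodBernoulli (fun e : Sym2 (Fin n) =>
            if (∀ x ∈ e, x ∈ S) ∧ ¬ e.IsDiag then 1 else w e)).real (openConn a' b)) →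
      (∀ (w' : Sym2 (Fin n) → unitInterval) (O' A' : Finset (Fin n)) (b' a' : Fin n),
        (Finset.univ.filter (fun x : Fin n => x ∉ O' ∧ ∃ e : Sym2 (Fin n), x ∈ e ∧ w' e ≠ 0)).card ≤
          (Finset.univ.filter (fun x : Fin n => x ∉ S ∧ ∃ e : Sym2 (Fin n), x ∈ e ∧ w e ≠ 0)).card →
        Disjoint O' A' → b' ∉ O' → a' ∈ A' →
        (∀ a'' ∈ A',
          (prodBernoulli (fun e : Sym2 (Fin n) => if (∃ x ∈ e, x ∈ O') then 0 else w' e)).real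
              (openConn a' b') ≤
            (prodBernoulli (fun e : Sym2 (Fin n) => if (∃ x ∈ e, x ∈ O') then 0 else w' e)).real
              (openConn a'' b')) →
        (prodBernoulli (fun e : Sym2 (Fin n) =>
            if (∀ x ∈ e, x ∈ O') ∧ ¬ e.IsDiag then 1 else w' e)).real (⋃ o ∈ O', ⋃ x ∈ A', openConn o x) -
          (prodBernoulli (fun e : Sym2 (Fin n) =>
            if (∀ x ∈ e, x ∈ O') ∧ ¬ e.IsDiag then 1 else w' e)).real (⋃ o ∈ O', openConn o b') ≤
          1 - (prodBernoulli (fun e : Sym2 (Fin n) =>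
            if (∀ x ∈ e, x ∈ O') ∧ ¬ e.IsDiag then 1 else w' e)).real (openConn a' b')) →
      (prodBernoulli (fun e : Sym2 (Fin n) =>
          if (∀ x ∈ e, x ∈ S) ∧ ¬ e.IsDiag then 1 else w e)).real (⋃ s ∈ S, ⋃ x ∈ A, openConn s x) -
        (prodBernoulli (fun e : Sym2 (Fin n) =>
          if (∀ x ∈ e, x ∈ S) ∧ ¬ e.IsDiag then 1 else w e)).real (⋃ s ∈ S, openConn s b) ≤
        1 - (prodBernoulli (fun e : Sym2 (Fin n) =>
          if (∀ x ∈ e, x ∈ S) ∧ ¬ e.IsDiag then 1 else w e)).real (openConn a b) := by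
  intro n w S A b a hS hSA hb ha hmin hIH hAll
  -- the minimiser `a₁` of the block-deleted reliability
  obtain ⟨a₁, ha₁, hmin₁⟩ := Finset.exists_min_image A
    (fun x => (prodBernoulli (fun e : Sym2 (Fin n) => if (∃ x ∈ e, x ∈ S) then 0 else w e)).real
      (openConn x b)) ⟨a, ha⟩
  have hIH₁ := hIH a₁ ha₁ hmin₁
  -- no drift: the induction hypothesis already gives the claim
  by_cases hdrift : (prodBernoulli (fun e : Sym2 (Fin n) =>
      if (∀ x ∈ e, x ∈ S) ∧ ¬ e.IsDiag then 1 else w e)).real (openConn a b) ≤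
        (prodBernoulli (fun e : Sym2 (Fin n) =>
          if (∀ x ∈ e, x ∈ S) ∧ ¬ e.IsDiag then 1 else w e)).real (openConn a₁ b)
  · linarith
  push Not at hdrift
  -- genuine drift: three relays → the core; at most two relays → the two-relay lemma
  by_cases h3 : ∃ a₂ ∈ A, a₂ ≠ a ∧ a₂ ≠ a₁
  · exact stub_gluingDefectCore n w S A b a a₁ hS hSA hb ha
      (fun w' a₁' a₂' b' Q d => stub_knLemma3ii n w' a₁' a₂' b' Q d)
      (fun w' S' a₁' a₂' b' => stub_knThm1Set n w' S' a₁' a₂' b')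
      (stub_gluePushforward n) (stub_glueReach n) hmin hIH hAll ha₁ hmin₁ hdrift h3
  · push Not at h3
    have haS : a ∉ S := fun h => Finset.disjoint_left.1 hSA h ha
    have ha₁S : a₁ ∉ S := fun h => Finset.disjoint_left.1 hSA h ha₁
    have htwo := stub_defectTwoRelays n (stub_knLemma3ii n) (stub_gluePushforward n)
      (stub_glueReach n) w S a a₁ b hb haS ha₁S (hmin a₁ ha₁)
    have hsub : (⋃ s ∈ S, ⋃ x ∈ A, (openConn s x : Set (BondConfig (Fin n)))) ⊆
        ⋃ s ∈ S, (openConn s a ∪ openConn s a₁) := by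
      intro ω hω
      simp only [Set.mem_iUnion, exists_prop] at hω
      obtain ⟨s, hs, x, hx, hωx⟩ := hω
      simp only [Set.mem_iUnion, exists_prop, Set.mem_union]
      refine ⟨s, hs, ?_⟩
      by_cases hxa : x = a
      · exact Or.inl (hxa ▸ hωx)
      · have hxa₁ : x = a₁ := h3 x hx hxa
        exact Or.inr (hxa₁ ▸ hωx)
    have hmono := measureReal_mono (μ := prodBernoulli (fun e : Sym2 (Fin n) =>
      if (∀ x ∈ e, x ∈ S) ∧ ¬ e.IsDiag then 1 else w e)) hsub (measure_ne_top _ _)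
    linarith

/-! ### Partial-result stubs (registered so that the line's SORRY-FREE partial results can land as
`--supports` files; both are PROVED in `Theorems/PercNearOneGluingAdditiveGluingPartial.lean` by the very
recursion of this skeleton, specialised so that `stub_gluingDefectCore` is never invoked). -/

/-- **stub_agCardLeTwo — AdditiveGluing for at most two relays** (the σ-recursion closes without its open
core when `A.card ≤ 2`: no drift ⇒ induction hypothesis, drift ⇒ `A = {a, a₁}` and `stub_defectTwoRelays`).
In print: Kozma–Nitzan arXiv:2401.12397 Thm 1 with `(1−x)(1−y) ≥ 1−x−y`. Proved in the Partial file. -/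
theorem stub_agCardLeTwo :
    ∀ (n : ℕ) (w : Sym2 (Fin n) → unitInterval) (A : Finset (Fin n)) (o b : Fin n) (t : ℝ),
      A.card ≤ 2 → 0 ≤ t →
      (∀ a ∈ A, 1 - t ≤ (prodBernoulli w).real (openConn a b)) →
      (prodBernoulli w).real (⋃ a ∈ A, openConn o a) - t ≤ (prodBernoulli w).real (openConn o b) := by
  -- LANDED (p92222, ACCEPTED 2026-08-16): Theorems/PercNearOneGluingAdditiveGluingPartial.lean
  exact Summit.CriticalPhenomena.PercolationContinuityZ3.Theorems.stub_agCardLeTwo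

/-- **stub_agIsolated — AdditiveGluing for an observer isolated in `G ∖ A`** (Kozma–Nitzan Thm 4's class,
additive form, any number of relays): one application of the engine at the block `{o}`; every non-empty
σ-layer meets `A`, so the defect branch is vacuous. Proved in the Partial file. -/
theorem stub_agIsolated :
    ∀ (n : ℕ) (w : Sym2 (Fin n) → unitInterval) (A : Finset (Fin n)) (o b : Fin n) (t : ℝ),
      (∀ y : Fin n, y ∉ A → y ≠ o → w s(o, y) = 0) → 0 ≤ t →
      (∀ a ∈ A, 1 - t ≤ (prodBernoulli w).real (openConn a b)) →
      (prodBernoulli w).real (⋃ a ∈ A, openConn o a) - t ≤ (prodBernoulli w).real (openConn o b) := by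
  -- LANDED (p92222, ACCEPTED 2026-08-16): Theorems/PercNearOneGluingAdditiveGluingPartial.lean
  exact Summit.CriticalPhenomena.PercolationContinuityZ3.Theorems.stub_agIsolated

/-! ## Glue (real proofs) -/

theorem glue_singleton (w : Sym2 (Fin n) → unitInterval) (o : Fin n) : glue w {o} = w := by
  funext e
  induction e using Sym2.ind with
  | h x y =>
    unfold glue
    split_ifs with h
    · exfalso
      obtain ⟨h1, h2⟩ := h
      have hx : x = o := by simpa using h1 x (Sym2.mem_mk_left x y)
      have hy : y = o := by simpa using h1 y (Sym2.mem_mk_right x y)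
      exact h2 (by rw [Sym2.mk_isDiag_iff]; rw [hx, hy])
    · rfl

theorem blockConn_singleton_left (o : Fin n) (X : Finset (Fin n)) :
    blockConn {o} X = ⋃ x ∈ X, openConn o x := by
  unfold blockConn
  exact Finset.set_biUnion_singleton o _

theorem blockPt_singleton (o b : Fin n) :
    blockPt ({o} : Finset (Fin n)) b = openConn o b := by
  unfold blockPt
  exact Finset.set_biUnion_singleton o _

theorem live_kill_ssubset (w : Sym2 (Fin n) → unitInterval) (O S : Finset (Fin n))
    (hS : IsPosLayer w O S) (hne : S.Nonempty) : live (kill w O) S ⊂ live w O := by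
  have hsub : live (kill w O) S ⊆ live w O := by
    intro x hx
    simp only [live, Finset.mem_filter, Finset.mem_univ, true_and] at hx ⊢
    obtain ⟨hxS, e, hxe, hwe⟩ := hx
    unfold kill at hwe
    split_ifs at hwe with hex
    · exact absurd rfl hwe
    · push Not at hex
      exact ⟨hex x hxe, e, hxe, hwe⟩
  obtain ⟨x, hxS⟩ := hne
  obtain ⟨hxO, o, hoO, hwo⟩ := hS x hxS
  refine (Finset.ssubset_iff_of_subset hsub).2 ⟨x, ?_, ?_⟩
  · simp only [live, Finset.mem_filter, Finset.mem_univ, true_and]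
    exact ⟨hxO, s(o, x), Sym2.mem_mk_right o x, hwo⟩
  · simp only [live, Finset.mem_filter, Finset.mem_univ, true_and, not_and]
    intro h
    exact absurd hxS h

theorem live_kill_card_lt (w : Sym2 (Fin n) → unitInterval) (O S : Finset (Fin n))
    (hS : IsPosLayer w O S) (hne : S.Nonempty) : (live (kill w O) S).card < (live w O).card :=
  Finset.card_lt_card (live_kill_ssubset w O S hS hne)

/-! ## Composition -/

/-- The recursion: strong induction on the number of live vertices outside the block.  The
hypotheses are LITERALLY the statements of the five registered stubs. -/
theorem designated_of_stubs
    (h3 : ∀ (n : ℕ) (w : Sym2 (Fin n) → unitInterval) (S : Finset (Fin n)) (a v b : Fin n),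
      v ∈ S → b ∉ S →
      (prodBernoulli w).real (openConn a b) ≤ (prodBernoulli w).real (openConn v b) →
      (prodBernoulli (fun e : Sym2 (Fin n) =>
          if (∀ x ∈ e, x ∈ S) ∧ ¬ e.IsDiag then 1 else w e)).real (openConn a b) ≤
        (prodBernoulli (fun e : Sym2 (Fin n) =>
          if (∀ x ∈ e, x ∈ S) ∧ ¬ e.IsDiag then 1 else w e)).real (⋃ s ∈ S, openConn s b))
    (hgeo : ∀ (n : ℕ) (O S : Finset (Fin n)) (ω : BondConfig (Fin n)),
      (∀ x : Fin n, x ∈ S ↔ (x ∉ O ∧ ∃ o ∈ O, s(o, x) ∈ ω)) →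
      (∀ o ∈ O, ∀ o' ∈ O, o ≠ o' → s(o, o') ∈ ω) →
      (∀ X : Finset (Fin n), Disjoint O X →
          (ω ∈ (⋃ o ∈ O, ⋃ x ∈ X, openConn o x) ↔
            ({e | e ∈ ω ∧ ∀ x ∈ e, x ∉ O} ∪ {e | (∀ x ∈ e, x ∈ S) ∧ ¬ e.IsDiag}) ∈
              (⋃ s ∈ S, ⋃ x ∈ X, openConn s x))) ∧
      (∀ u v : Fin n, u ∉ O → v ∉ O →
          (ω ∈ openConn u v ↔
            ({e | e ∈ ω ∧ ∀ x ∈ e, x ∉ O} ∪ {e | (∀ x ∈ e, x ∈ S) ∧ ¬ e.IsDiag}) ∈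
              openConn u v)))
    (hlaw : ∀ (n : ℕ) (w : Sym2 (Fin n) → unitInterval) (O S : Finset (Fin n))
      (E : Set (BondConfig (Fin n))),
      (prodBernoulli (fun e : Sym2 (Fin n) =>
          if (∀ x ∈ e, x ∈ O) ∧ ¬ e.IsDiag then 1 else w e)).real
          ({ω | ∀ x : Fin n, x ∈ S ↔ (x ∉ O ∧ ∃ o ∈ O, s(o, x) ∈ ω)} ∩
            {ω | ({e | e ∈ ω ∧ ∀ x ∈ e, x ∉ O} ∪ {e | (∀ x ∈ e, x ∈ S) ∧ ¬ e.IsDiag}) ∈ E}) =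
        (prodBernoulli (fun e : Sym2 (Fin n) =>
            if (∀ x ∈ e, x ∈ O) ∧ ¬ e.IsDiag then 1 else w e)).real
            {ω | ∀ x : Fin n, x ∈ S ↔ (x ∉ O ∧ ∃ o ∈ O, s(o, x) ∈ ω)} *
          (prodBernoulli (fun e : Sym2 (Fin n) =>
            if (∀ x ∈ e, x ∈ S) ∧ ¬ e.IsDiag then 1 else
              if (∃ x ∈ e, x ∈ O) then 0 else w e)).real E)
    (h4 : ∀ (n : ℕ) (w : Sym2 (Fin n) → unitInterval) (O A : Finset (Fin n)) (b a : Fin n),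
      Disjoint O A → b ∉ O → a ∈ A →
      (∀ (S : Finset (Fin n)) (ω : BondConfig (Fin n)),
        (∀ x : Fin n, x ∈ S ↔ (x ∉ O ∧ ∃ o ∈ O, s(o, x) ∈ ω)) →
        (∀ o ∈ O, ∀ o' ∈ O, o ≠ o' → s(o, o') ∈ ω) →
        (∀ X : Finset (Fin n), Disjoint O X →
            (ω ∈ (⋃ o ∈ O, ⋃ x ∈ X, openConn o x) ↔
              ({e | e ∈ ω ∧ ∀ x ∈ e, x ∉ O} ∪ {e | (∀ x ∈ e, x ∈ S) ∧ ¬ e.IsDiag}) ∈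
                (⋃ s ∈ S, ⋃ x ∈ X, openConn s x))) ∧
        (∀ u v : Fin n, u ∉ O → v ∉ O →
            (ω ∈ openConn u v ↔
              ({e | e ∈ ω ∧ ∀ x ∈ e, x ∉ O} ∪ {e | (∀ x ∈ e, x ∈ S) ∧ ¬ e.IsDiag}) ∈
                openConn u v))) →
      (∀ (S : Finset (Fin n)) (E : Set (BondConfig (Fin n))),
        (prodBernoulli (fun e : Sym2 (Fin n) =>
            if (∀ x ∈ e, x ∈ O) ∧ ¬ e.IsDiag then 1 else w e)).real
            ({ω | ∀ x : Fin n, x ∈ S ↔ (x ∉ O ∧ ∃ o ∈ O, s(o, x) ∈ ω)} ∩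
              {ω | ({e | e ∈ ω ∧ ∀ x ∈ e, x ∉ O} ∪ {e | (∀ x ∈ e, x ∈ S) ∧ ¬ e.IsDiag}) ∈ E}) =
          (prodBernoulli (fun e : Sym2 (Fin n) =>
              if (∀ x ∈ e, x ∈ O) ∧ ¬ e.IsDiag then 1 else w e)).real
              {ω | ∀ x : Fin n, x ∈ S ↔ (x ∉ O ∧ ∃ o ∈ O, s(o, x) ∈ ω)} *
            (prodBernoulli (fun e : Sym2 (Fin n) =>
              if (∀ x ∈ e, x ∈ S) ∧ ¬ e.IsDiag then 1 else
                if (∃ x ∈ e, x ∈ O) then 0 else w e)).real E) →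
      (∀ S : Finset (Fin n), (∀ x ∈ S, x ∉ O ∧ ∃ o ∈ O, w s(o, x) ≠ 0) →
        (S ∩ A).Nonempty → b ∉ S →
        (prodBernoulli (fun e : Sym2 (Fin n) =>
            if (∀ x ∈ e, x ∈ S) ∧ ¬ e.IsDiag then 1 else
              if (∃ x ∈ e, x ∈ O) then 0 else w e)).real (openConn a b) ≤
          (prodBernoulli (fun e : Sym2 (Fin n) =>
            if (∀ x ∈ e, x ∈ S) ∧ ¬ e.IsDiag then 1 else
              if (∃ x ∈ e, x ∈ O) then 0 else w e)).real (⋃ s ∈ S, openConn s b)) →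
      (∀ S : Finset (Fin n), (∀ x ∈ S, x ∉ O ∧ ∃ o ∈ O, w s(o, x) ≠ 0) →
        S.Nonempty → Disjoint S A → b ∉ S →
        (prodBernoulli (fun e : Sym2 (Fin n) =>
            if (∀ x ∈ e, x ∈ S) ∧ ¬ e.IsDiag then 1 else
              if (∃ x ∈ e, x ∈ O) then 0 else w e)).real (⋃ s ∈ S, ⋃ x ∈ A, openConn s x) -
          (prodBernoulli (fun e : Sym2 (Fin n) =>
            if (∀ x ∈ e, x ∈ S) ∧ ¬ e.IsDiag then 1 else
              if (∃ x ∈ e, x ∈ O) then 0 else w e)).real (⋃ s ∈ S, openConn s b) ≤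
          1 - (prodBernoulli (fun e : Sym2 (Fin n) =>
            if (∀ x ∈ e, x ∈ S) ∧ ¬ e.IsDiag then 1 else
              if (∃ x ∈ e, x ∈ O) then 0 else w e)).real (openConn a b)) →
      (prodBernoulli (fun e : Sym2 (Fin n) =>
          if (∀ x ∈ e, x ∈ O) ∧ ¬ e.IsDiag then 1 else w e)).real (⋃ o ∈ O, ⋃ x ∈ A, openConn o x) -
        (prodBernoulli (fun e : Sym2 (Fin n) =>
          if (∀ x ∈ e, x ∈ O) ∧ ¬ e.IsDiag then 1 else w e)).real (⋃ o ∈ O, openConn o b) ≤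
        1 - (prodBernoulli (fun e : Sym2 (Fin n) =>
          if (∀ x ∈ e, x ∈ O) ∧ ¬ e.IsDiag then 1 else w e)).real (openConn a b))
    (h5 : ∀ (n : ℕ) (w : Sym2 (Fin n) → unitInterval) (S A : Finset (Fin n)) (b a : Fin n),
      S.Nonempty → Disjoint S A → b ∉ S → a ∈ A →
      (∀ a' ∈ A, (prodBernoulli w).real (openConn a b) ≤ (prodBernoulli w).real (openConn a' b)) →
      (∀ a' ∈ A,
        (∀ a'' ∈ A,
          (prodBernoulli (fun e : Sym2 (Fin n) => if (∃ x ∈ e, x ∈ S) then 0 else w e)).real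
              (openConn a' b) ≤
            (prodBernoulli (fun e : Sym2 (Fin n) => if (∃ x ∈ e, x ∈ S) then 0 else w e)).real
              (openConn a'' b)) →
        (prodBernoulli (fun e : Sym2 (Fin n) =>
            if (∀ x ∈ e, x ∈ S) ∧ ¬ e.IsDiag then 1 else w e)).real (⋃ s ∈ S, ⋃ x ∈ A, openConn s x) -
          (prodBernoulli (fun e : Sym2 (Fin n) =>
            if (∀ x ∈ e, x ∈ S) ∧ ¬ e.IsDiag then 1 else w e)).real (⋃ s ∈ S, openConn s b) ≤
          1 - (prodBernoulli (fun e : Sym2 (Fin n) =>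
            if (∀ x ∈ e, x ∈ S) ∧ ¬ e.IsDiag then 1 else w e)).real (openConn a' b)) →
      (∀ (w' : Sym2 (Fin n) → unitInterval) (O' A' : Finset (Fin n)) (b' a' : Fin n),
        (Finset.univ.filter (fun x : Fin n => x ∉ O' ∧ ∃ e : Sym2 (Fin n), x ∈ e ∧ w' e ≠ 0)).card ≤
          (Finset.univ.filter (fun x : Fin n => x ∉ S ∧ ∃ e : Sym2 (Fin n), x ∈ e ∧ w e ≠ 0)).card →
        Disjoint O' A' → b' ∉ O' → a' ∈ A' →
        (∀ a'' ∈ A',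
          (prodBernoulli (fun e : Sym2 (Fin n) => if (∃ x ∈ e, x ∈ O') then 0 else w' e)).real
              (openConn a' b') ≤
            (prodBernoulli (fun e : Sym2 (Fin n) => if (∃ x ∈ e, x ∈ O') then 0 else w' e)).real
              (openConn a'' b')) →
        (prodBernoulli (fun e : Sym2 (Fin n) =>
            if (∀ x ∈ e, x ∈ O') ∧ ¬ e.IsDiag then 1 else w' e)).real (⋃ o ∈ O', ⋃ x ∈ A', openConn o x) -
          (prodBernoulli (fun e : Sym2 (Fin n) =>
            if (∀ x ∈ e, x ∈ O') ∧ ¬ e.IsDiag then 1 else w' e)).real (⋃ o ∈ O', openConn o b') ≤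
          1 - (prodBernoulli (fun e : Sym2 (Fin n) =>
            if (∀ x ∈ e, x ∈ O') ∧ ¬ e.IsDiag then 1 else w' e)).real (openConn a' b')) →
      (prodBernoulli (fun e : Sym2 (Fin n) =>
          if (∀ x ∈ e, x ∈ S) ∧ ¬ e.IsDiag then 1 else w e)).real (⋃ s ∈ S, ⋃ x ∈ A, openConn s x) -
        (prodBernoulli (fun e : Sym2 (Fin n) =>
          if (∀ x ∈ e, x ∈ S) ∧ ¬ e.IsDiag then 1 else w e)).real (⋃ s ∈ S, openConn s b) ≤
        1 - (prodBernoulli (fun e : Sym2 (Fin n) =>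
          if (∀ x ∈ e, x ∈ S) ∧ ¬ e.IsDiag then 1 else w e)).real (openConn a b)) :
    ∀ (m : ℕ) (n : ℕ) (w : Sym2 (Fin n) → unitInterval) (O A : Finset (Fin n)) (b a : Fin n),
      (live w O).card = m → Disjoint O A → b ∉ O → a ∈ A →
      (∀ a' ∈ A, (prodBernoulli (kill w O)).real (openConn a b) ≤
        (prodBernoulli (kill w O)).real (openConn a' b)) →
      AGd w O A b a := by
  intro m
  induction m using Nat.strong_induction_on with
  | _ m IH =>
    intro n w O A b a hm hOA hb ha hmin
    have key := h4 n w O A b a hOA hb ha (hgeo n O) (hlaw n w O) ?_ ?_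
    · exact key
    · intro S _ hSA hbS
      obtain ⟨v, hv⟩ := hSA
      rw [Finset.mem_inter] at hv
      exact h3 n (kill w O) S a v b hv.1 hbS (hmin v hv.2)
    · intro S hS hSne hSA hbS
      refine h5 n (kill w O) S A b a hSne hSA hbS ha hmin ?_ ?_
      · intro a' ha'A hmin'
        exact IH _ (hm ▸ live_kill_card_lt w O S hS hSne) n (kill w O) S A b a' rfl hSA hbS
          ha'A hmin'
      · -- the FULL induction hypothesis: every state with at most as many live vertices
        intro w' O' A' b' a' hcard hO'A' hb' ha' hmin'
        exact IH _ (lt_of_le_of_lt hcard (hm ▸ live_kill_card_lt w O S hS hSne)) n w' O' A' b' a'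
          rfl hO'A' hb' ha' hmin'

/-- **Composition, logical core (sorry-free, axioms `propext`/`Classical.choice`/`Quot.sound`).**
The five stub STATEMENTS imply the crux; the conclusion is written out (it is `AdditiveGluing`
unfolded, definitionally) so that the only theorem concluding the crux BY NAME is
`AdditiveGluing_of` below, whose proof names the stubs. -/
theorem additiveGluing_core
    (h3 : ∀ (n : ℕ) (w : Sym2 (Fin n) → unitInterval) (S : Finset (Fin n)) (a v b : Fin n),
      v ∈ S → b ∉ S →
      (prodBernoulli w).real (openConn a b) ≤ (prodBernoulli w).real (openConn v b) →
      (prodBernoulli (fun e : Sym2 (Fin n) =>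
          if (∀ x ∈ e, x ∈ S) ∧ ¬ e.IsDiag then 1 else w e)).real (openConn a b) ≤
        (prodBernoulli (fun e : Sym2 (Fin n) =>
          if (∀ x ∈ e, x ∈ S) ∧ ¬ e.IsDiag then 1 else w e)).real (⋃ s ∈ S, openConn s b))
    (hgeo : ∀ (n : ℕ) (O S : Finset (Fin n)) (ω : BondConfig (Fin n)),
      (∀ x : Fin n, x ∈ S ↔ (x ∉ O ∧ ∃ o ∈ O, s(o, x) ∈ ω)) →
      (∀ o ∈ O, ∀ o' ∈ O, o ≠ o' → s(o, o') ∈ ω) →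
      (∀ X : Finset (Fin n), Disjoint O X →
          (ω ∈ (⋃ o ∈ O, ⋃ x ∈ X, openConn o x) ↔
            ({e | e ∈ ω ∧ ∀ x ∈ e, x ∉ O} ∪ {e | (∀ x ∈ e, x ∈ S) ∧ ¬ e.IsDiag}) ∈
              (⋃ s ∈ S, ⋃ x ∈ X, openConn s x))) ∧
      (∀ u v : Fin n, u ∉ O → v ∉ O →
          (ω ∈ openConn u v ↔
            ({e | e ∈ ω ∧ ∀ x ∈ e, x ∉ O} ∪ {e | (∀ x ∈ e, x ∈ S) ∧ ¬ e.IsDiag}) ∈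
              openConn u v)))
    (hlaw : ∀ (n : ℕ) (w : Sym2 (Fin n) → unitInterval) (O S : Finset (Fin n))
      (E : Set (BondConfig (Fin n))),
      (prodBernoulli (fun e : Sym2 (Fin n) =>
          if (∀ x ∈ e, x ∈ O) ∧ ¬ e.IsDiag then 1 else w e)).real
          ({ω | ∀ x : Fin n, x ∈ S ↔ (x ∉ O ∧ ∃ o ∈ O, s(o, x) ∈ ω)} ∩
            {ω | ({e | e ∈ ω ∧ ∀ x ∈ e, x ∉ O} ∪ {e | (∀ x ∈ e, x ∈ S) ∧ ¬ e.IsDiag}) ∈ E}) =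
        (prodBernoulli (fun e : Sym2 (Fin n) =>
            if (∀ x ∈ e, x ∈ O) ∧ ¬ e.IsDiag then 1 else w e)).real
            {ω | ∀ x : Fin n, x ∈ S ↔ (x ∉ O ∧ ∃ o ∈ O, s(o, x) ∈ ω)} *
          (prodBernoulli (fun e : Sym2 (Fin n) =>
            if (∀ x ∈ e, x ∈ S) ∧ ¬ e.IsDiag then 1 else
              if (∃ x ∈ e, x ∈ O) then 0 else w e)).real E)
    (h4 : ∀ (n : ℕ) (w : Sym2 (Fin n) → unitInterval) (O A : Finset (Fin n)) (b a : Fin n),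
      Disjoint O A → b ∉ O → a ∈ A →
      (∀ (S : Finset (Fin n)) (ω : BondConfig (Fin n)),
        (∀ x : Fin n, x ∈ S ↔ (x ∉ O ∧ ∃ o ∈ O, s(o, x) ∈ ω)) →
        (∀ o ∈ O, ∀ o' ∈ O, o ≠ o' → s(o, o') ∈ ω) →
        (∀ X : Finset (Fin n), Disjoint O X →
            (ω ∈ (⋃ o ∈ O, ⋃ x ∈ X, openConn o x) ↔
              ({e | e ∈ ω ∧ ∀ x ∈ e, x ∉ O} ∪ {e | (∀ x ∈ e, x ∈ S) ∧ ¬ e.IsDiag}) ∈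
                (⋃ s ∈ S, ⋃ x ∈ X, openConn s x))) ∧
        (∀ u v : Fin n, u ∉ O → v ∉ O →
            (ω ∈ openConn u v ↔
              ({e | e ∈ ω ∧ ∀ x ∈ e, x ∉ O} ∪ {e | (∀ x ∈ e, x ∈ S) ∧ ¬ e.IsDiag}) ∈
                openConn u v))) →
      (∀ (S : Finset (Fin n)) (E : Set (BondConfig (Fin n))),
        (prodBernoulli (fun e : Sym2 (Fin n) =>
            if (∀ x ∈ e, x ∈ O) ∧ ¬ e.IsDiag then 1 else w e)).real
            ({ω | ∀ x : Fin n, x ∈ S ↔ (x ∉ O ∧ ∃ o ∈ O, s(o, x) ∈ ω)} ∩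
              {ω | ({e | e ∈ ω ∧ ∀ x ∈ e, x ∉ O} ∪ {e | (∀ x ∈ e, x ∈ S) ∧ ¬ e.IsDiag}) ∈ E}) =
          (prodBernoulli (fun e : Sym2 (Fin n) =>
              if (∀ x ∈ e, x ∈ O) ∧ ¬ e.IsDiag then 1 else w e)).real
              {ω | ∀ x : Fin n, x ∈ S ↔ (x ∉ O ∧ ∃ o ∈ O, s(o, x) ∈ ω)} *
            (prodBernoulli (fun e : Sym2 (Fin n) =>
              if (∀ x ∈ e, x ∈ S) ∧ ¬ e.IsDiag then 1 else
                if (∃ x ∈ e, x ∈ O) then 0 else w e)).real E) →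
      (∀ S : Finset (Fin n), (∀ x ∈ S, x ∉ O ∧ ∃ o ∈ O, w s(o, x) ≠ 0) →
        (S ∩ A).Nonempty → b ∉ S →
        (prodBernoulli (fun e : Sym2 (Fin n) =>
            if (∀ x ∈ e, x ∈ S) ∧ ¬ e.IsDiag then 1 else
              if (∃ x ∈ e, x ∈ O) then 0 else w e)).real (openConn a b) ≤
          (prodBernoulli (fun e : Sym2 (Fin n) =>
            if (∀ x ∈ e, x ∈ S) ∧ ¬ e.IsDiag then 1 else
              if (∃ x ∈ e, x ∈ O) then 0 else w e)).real (⋃ s ∈ S, openConn s b)) →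
      (∀ S : Finset (Fin n), (∀ x ∈ S, x ∉ O ∧ ∃ o ∈ O, w s(o, x) ≠ 0) →
        S.Nonempty → Disjoint S A → b ∉ S →
        (prodBernoulli (fun e : Sym2 (Fin n) =>
            if (∀ x ∈ e, x ∈ S) ∧ ¬ e.IsDiag then 1 else
              if (∃ x ∈ e, x ∈ O) then 0 else w e)).real (⋃ s ∈ S, ⋃ x ∈ A, openConn s x) -
          (prodBernoulli (fun e : Sym2 (Fin n) =>
            if (∀ x ∈ e, x ∈ S) ∧ ¬ e.IsDiag then 1 else
              if (∃ x ∈ e, x ∈ O) then 0 else w e)).real (⋃ s ∈ S, openConn s b) ≤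
          1 - (prodBernoulli (fun e : Sym2 (Fin n) =>
            if (∀ x ∈ e, x ∈ S) ∧ ¬ e.IsDiag then 1 else
              if (∃ x ∈ e, x ∈ O) then 0 else w e)).real (openConn a b)) →
      (prodBernoulli (fun e : Sym2 (Fin n) =>
          if (∀ x ∈ e, x ∈ O) ∧ ¬ e.IsDiag then 1 else w e)).real (⋃ o ∈ O, ⋃ x ∈ A, openConn o x) -
        (prodBernoulli (fun e : Sym2 (Fin n) =>
          if (∀ x ∈ e, x ∈ O) ∧ ¬ e.IsDiag then 1 else w e)).real (⋃ o ∈ O, openConn o b) ≤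
        1 - (prodBernoulli (fun e : Sym2 (Fin n) =>
          if (∀ x ∈ e, x ∈ O) ∧ ¬ e.IsDiag then 1 else w e)).real (openConn a b))
    (h5 : ∀ (n : ℕ) (w : Sym2 (Fin n) → unitInterval) (S A : Finset (Fin n)) (b a : Fin n),
      S.Nonempty → Disjoint S A → b ∉ S → a ∈ A →
      (∀ a' ∈ A, (prodBernoulli w).real (openConn a b) ≤ (prodBernoulli w).real (openConn a' b)) →
      (∀ a' ∈ A,
        (∀ a'' ∈ A,
          (prodBernoulli (fun e : Sym2 (Fin n) => if (∃ x ∈ e, x ∈ S) then 0 else w e)).real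
              (openConn a' b) ≤
            (prodBernoulli (fun e : Sym2 (Fin n) => if (∃ x ∈ e, x ∈ S) then 0 else w e)).real
              (openConn a'' b)) →
        (prodBernoulli (fun e : Sym2 (Fin n) =>
            if (∀ x ∈ e, x ∈ S) ∧ ¬ e.IsDiag then 1 else w e)).real (⋃ s ∈ S, ⋃ x ∈ A, openConn s x) -
          (prodBernoulli (fun e : Sym2 (Fin n) =>
            if (∀ x ∈ e, x ∈ S) ∧ ¬ e.IsDiag then 1 else w e)).real (⋃ s ∈ S, openConn s b) ≤
          1 - (prodBernoulli (fun e : Sym2 (Fin n) =>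
            if (∀ x ∈ e, x ∈ S) ∧ ¬ e.IsDiag then 1 else w e)).real (openConn a' b)) →
      (∀ (w' : Sym2 (Fin n) → unitInterval) (O' A' : Finset (Fin n)) (b' a' : Fin n),
        (Finset.univ.filter (fun x : Fin n => x ∉ O' ∧ ∃ e : Sym2 (Fin n), x ∈ e ∧ w' e ≠ 0)).card ≤
          (Finset.univ.filter (fun x : Fin n => x ∉ S ∧ ∃ e : Sym2 (Fin n), x ∈ e ∧ w e ≠ 0)).card →
        Disjoint O' A' → b' ∉ O' → a' ∈ A' →
        (∀ a'' ∈ A',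
          (prodBernoulli (fun e : Sym2 (Fin n) => if (∃ x ∈ e, x ∈ O') then 0 else w' e)).real
              (openConn a' b') ≤
            (prodBernoulli (fun e : Sym2 (Fin n) => if (∃ x ∈ e, x ∈ O') then 0 else w' e)).real
              (openConn a'' b')) →
        (prodBernoulli (fun e : Sym2 (Fin n) =>
            if (∀ x ∈ e, x ∈ O') ∧ ¬ e.IsDiag then 1 else w' e)).real (⋃ o ∈ O', ⋃ x ∈ A', openConn o x) -
          (prodBernoulli (fun e : Sym2 (Fin n) =>
            if (∀ x ∈ e, x ∈ O') ∧ ¬ e.IsDiag then 1 else w' e)).real (⋃ o ∈ O', openConn o b') ≤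
          1 - (prodBernoulli (fun e : Sym2 (Fin n) =>
            if (∀ x ∈ e, x ∈ O') ∧ ¬ e.IsDiag then 1 else w' e)).real (openConn a' b')) →
      (prodBernoulli (fun e : Sym2 (Fin n) =>
          if (∀ x ∈ e, x ∈ S) ∧ ¬ e.IsDiag then 1 else w e)).real (⋃ s ∈ S, ⋃ x ∈ A, openConn s x) -
        (prodBernoulli (fun e : Sym2 (Fin n) =>
          if (∀ x ∈ e, x ∈ S) ∧ ¬ e.IsDiag then 1 else w e)).real (⋃ s ∈ S, openConn s b) ≤
        1 - (prodBernoulli (fun e : Sym2 (Fin n) =>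
          if (∀ x ∈ e, x ∈ S) ∧ ¬ e.IsDiag then 1 else w e)).real (openConn a b)) :
    ∀ (n : ℕ) (w : Sym2 (Fin n) → unitInterval) (A : Finset (Fin n)) (o b : Fin n) (t : ℝ), 0 ≤ t →
      (∀ a ∈ A, 1 - t ≤ (prodBernoulli w).real (openConn a b)) →
      (prodBernoulli w).real (⋃ a ∈ A, openConn o a) - t ≤ (prodBernoulli w).real (openConn o b) := by
  intro n w A o b t ht hrel
  by_cases hoA : o ∈ A
  · have h1t := hrel o hoA
    have hle : (prodBernoulli w).real (⋃ a ∈ A, openConn o a) ≤ 1 := measureReal_le_one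
    linarith
  by_cases hbo : b = o
  · subst hbo
    have huniv : (openConn b b : Set (BondConfig (Fin n))) = Set.univ :=
      Set.eq_univ_of_forall fun _ => SimpleGraph.Reachable.refl _
    have hle : (prodBernoulli w).real (⋃ a ∈ A, openConn b a) ≤ 1 := measureReal_le_one
    rw [huniv, probReal_univ]
    linarith
  by_cases hA : A = ∅
  · subst hA
    have h0 : (prodBernoulli w).real (⋃ a ∈ (∅ : Finset (Fin n)), openConn o a) = 0 := by simp
    have hnn : 0 ≤ (prodBernoulli w).real (openConn o b) := measureReal_nonneg
    linarith
  obtain ⟨a, haA, hmin⟩ := Finset.exists_min_image A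
    (fun x => (prodBernoulli (kill w {o})).real (openConn x b)) (Finset.nonempty_iff_ne_empty.mpr hA)
  have hdis : Disjoint ({o} : Finset (Fin n)) A := Finset.disjoint_singleton_left.mpr hoA
  have hbO : b ∉ ({o} : Finset (Fin n)) := by rwa [Finset.mem_singleton]
  have key := designated_of_stubs h3 hgeo hlaw h4 h5 _ n w {o} A b a rfl hdis hbO haA hmin
  unfold AGd at key
  rw [glue_singleton, blockConn_singleton_left, blockPt_singleton] at key
  have hr := hrel a haA
  linarith

/-- **Composition.** The five registered stubs, BY NAME, give the crux `AdditiveGluing` (by name):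
`additiveGluing_core` applied to `stub_gluingLemma5`, `stub_sigmaGeometry`, `stub_sigmaLaw`,
`stub_sigmaRecursion`, `stub_gluingDefect` (this elaborates only because the core's hypothesis
types are literally the stub statements).  No `sorry` of its own; `sorryAx` enters only through
the stubs. -/
theorem AdditiveGluing_of : AdditiveGluing :=
  additiveGluing_core stub_gluingLemma5 stub_sigmaGeometry stub_sigmaLaw stub_sigmaRecursion
    stub_gluingDefect

end

end Summit.CriticalPhenomena.PercolationContinuityZ3.Cruxes.AdditiveGluing.SigmaRecursionLemma5AnyRelay
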